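import Summits.QuantumFields.BalabanUV.T4Continuum.Support.B13StepEnvelopeEndSubstrate
import Summits.QuantumFields.BalabanUV.T4Continuum.Support.B13StepEndInsOpBalaban
import Summits.QuantumFields.BalabanUV.T4Continuum.Support.SubstrateO1Readings

/-!
# B13StepEnvelopeEndSubstrateBalaban — NE5 ∕ U3: THE CAUCHY-ENVELOPE END FACE OF RECORD over the measurable operator carrier (E9[rec,sub]),
# STATED AT THE SUBSTRATE's O1 INSTANCE `SubstrateSlotsOfRecord.slotsOfRecord …` (substrate-p1, p220104; MAP §O1 O-8) WITH W1 PRODUCED AT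
# BAŁABAN's TIER-B BACKGROUND — W1 supplied by substrate-p1's `SubstrateO1Readings` (p225064) BY NAME, `hc₁ ∕ hθ0 ∕ hθ1` discharged by leaf-10's
# `B13StepEndInsOpBalaban` (p225077) §1 BY NAME; per two-run object and η-UNIFORMLY (`∃ C₅` outermost)

Cell `pub-balaban`, unit `b2b-balaban-t4-ne5-formalise-leaf-03` (NE5 formalisation swarm, LEAF PROVER 03, gen 13; typer `t4/formal/NE5/LEAVES.md` v2.7
CLAIM RULE 7 (b) ∕ CLAIM RULE 1: a landed END face APPLIED BY NAME at the substrate's O1 instance in a NEW `Support/B13*` module; journal INTENT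
`HOME/CLAIMS.log` 2026-08-20T17:0xZ).  The E9-road member of the family of «END ⇐ substrate instance letters, W1 produced» nodes: E1-insOp road =
leaf-10-g9's `B13StepEndInsOpSubstrate` (p226898), E8[rec] road = leaf-01-g16's `B13StepOfRecordSubstrateBalaban[Uniform]`, E9[rec] road = THIS FILE
— the substrate-instance follower of this lineage's model-level `B13StepEnvelopeEndBalaban` (p227161) and the W1-produced follower of this lineage's
`B13StepEnvelopeEndSubstrate` (p222736).  The E9[rec] lineage: `B13StepEnvelopeEnd` p214842 → `…Arithmetic` p214993 → `…Sub` p216841 → `…MeasOp`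
p217285 → `…Uniform` p218872 → `…Window` p218923 → `…Substrate` p222736 → `…Balaban` p227161.  Imports `B13StepEnvelopeEndSubstrate`, leaf-10's
`B13StepEndInsOpBalaban` (for `sqrt_rate_pos_lt_one` ∕ `c1_balaban_nonneg` BY NAME) and substrate-p1's `SubstrateO1Readings` ONLY (the η-uniform
companion imports this file + `B13StepEnvelopeEndUniform`); edits nothing; defines NO species reading (R41: W1 is the owner's, its instance the substrate's) and constructs ∕ discharges
NOTHING of the instance (R34) beyond the by-name readings listed below.  The substrate telescope and the NE3 ∕ O1 letter block are copied, with credit,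
from leaf-10-g9's p226898 §1 (same letter names `D ιr cc ag sg Pm 𝒵 domZ Jc Vv mI Lsl` ∕ `L M a ha o m α β C a′ η` ∕ `𝒞 N dom RgV tow σ dist₁ B₁ δ₁ …
Λ₅ hQ hR`), E9's own homonyms resolved as in p227161 (covariance entry decay `hdec₁`, majorant decay split `hdec`, `deltaKer` Lipschitz `hΦ`, anchored-norm
bound `hΦ′`) — so the three roads' substrate faces diff mechanically by their road binders.  Summits-side new work under the LEAN PLACEMENT RULE
(bookkeeping; 0 `def`, 0 cite tags — printed KIND only).
HONEST FRAMING: rung (B)+1 of the FINITE-VOLUME T⁴ continuum programme — NOT infinite volume, NOT a mass gap, NOT the Clay problem, and **NOT A PROOF OF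
NE5** (NOT PRINTED: the series prints ε-UNIFORM bounds, never η-RATES; cell GAPS G-t4-U3-1), NOT a proof of NE2 or NE3: every theorem is an IMPLICATION
whose wall binders are DISPLAYED HYPOTHESES — ABOUT THE SUBSTRATE's LETTERS (`SlotLetters`: factor letters, weights `W`, contour systems `ΓA ∕ ΓB`, kernel ∕
potential tables `dkA … pRB`, insertion letters `ins`, margins `rOp ∕ rHist`) and about node NE3's admissible data — asserted nowhere; among them W2-op
at factor level, `ActOpLineAnalyticOn` of the cores OF THE INSTANCE read through `↥measOp → OpDatum` (GAPS G-ne5p1-1′∕1″, NOT PRINTED), and U1b's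
`NE3Shape` (row NE3, OPEN).  The substrate's instance is NOT claimed to satisfy any of them.  R48 ∕ R49 HONEST LINE: `slotsOfRecord` is the VALUE-TABLE
model (poorer than print at MI-R, [Balaban1988RG2Cluster] Lemma 1 (1.33)); Road D `OutputRateFunctionalTables*` (leaf-02-g16 ∕ owner g35) is of record
for MI-R, instance = substrate; VALUE UNCHANGED.  HONEST DEPENDENCY (cell line, verbatim): continuum YM on T⁴ ⇐ BetaPertH ∧ nine spine estimates (0/9
proved); BetaPertH ⇐ (D1) ∧ (D4) ∧ CAP+tail; G-an2-4 gates asym, D1 and NE2/3/4.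

WHAT THIS FILE DOES (compositions BY NAME; no analytic estimate of its own).  At `S₀ := slotsOfRecord D ιr cc ag sg Pm 𝒵 domZ Jc Vv mI Lsl`, over the
sub-slot `M := measOp T (…) ι′ Ω 𝒴` (memberships `opA∕opB_mem_measOp_slotsOfRecord` from leaf-01-g11's six LETTER conditions, p221190 §1), four binders
of this lineage's E9[rec,sub] face at the instance `B13StepEnvelopeEndSubstrate.exists_ne5_of_substrate_restrict_envelope_actNormDecay` (p222736 §2)
are READ BY NAME: (i) W1 `hwer` := substrate-p1's `SubstrateO1Readings.weightedEntrywiseRate_slotsOfRecord_balaban_ne3Shape` (the owner's record face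
`B13ReadingsRecord.weightedEntrywiseRate_record_balaban_ne3Shape` AT the instance, slot lines `rfl`) — so U1b's `NE3Shape (minActReadings …) C θ`
(OPEN, row NE3), the (3.35)-class ∕ threshold letters and the owner's O1 reading ∕ decay ∕ Lipschitz ∕ domination letters AT THE SUBSTRATE's TABLES are
displayed instead, input rate `√(max θ L⁻¹)`; (ii)–(iv) `hc₁ ∕ hθ0 ∕ hθ1` := p225077 §1 (`c1_balaban_nonneg`, `sqrt_rate_pos_lt_one … hNE3.rate_lt_one`).
L01's reading stays p221190 §2's FACTORISATION DATUM `(iopAt, hiopA)` (`transportReads_slotsOfRecord_of_factor`; at the re-lettered package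
`Lsl.ofAt iopAt` it is substrate-p1's `iopA_ofAt`).  EVERY OTHER binder of p222736 §2 is displayed VERBATIM.
* §1 `exists_ne5_of_substrate_restrict_envelope_balaban_ne3Shape` — PER TWO-RUN OBJECT `D : DrivenRuns 𝔾` and letter package `Lsl`: conclusion
  LITERALLY `∃ C₅, T4OutputRate.NE5 (B13StepOfRecord.outA (slotsOfRecord …) E₀ cB) (B13StepOfRecord.outB (slotsOfRecord …) E₀ cB) W κ θ′ C₅` at the
  PRESCRIBED `θ′` (= p227161 §1 at `S₀ := slotsOfRecord …`, `M := measOp …`, slot lines `rfl` — the socket fit of leaf-10-g9's K-test l.17710, as a theorem).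
* §2 (companion module `B13StepEnvelopeEndSubstrateBalabanUniform`, split for the 400-line rule as leaf-01-g16's E8 pair)
  `uniform_ne5_of_substrate_restrict_envelope_balaban_ne3Shape` — ONE `C₅` from the SIZES ONLY (`κ, Φ′, EA₀, E₀, cA, cB, r₀, δ′, θ′, ω`, W1's
  constant letters `o, d, L, a, α, β, C, a′, B₁, B₂, B₃, Λ₂, …, Λ₅`, U1b's `θ < 1`) for EVERY gauge group `𝔾`, driven two-run object `D`,
  representation `ιr`, letters `cc ag sg`, frame `Pm`, insertion-operator sort `IOp`, factor index data, EVERY letter package `Lsl` with `Lsl.ins.ω = ω`,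
  its six letter conditions and factorisation datum, admissible data `dom ∕ 𝒞 ∕ N ∕ RgV` in U1b's shape at `(C, θ)`, towers over `D`'s run-B
  backgrounds, O1 letters, window, roomy class, majorants `A ∕ A′` with decay split and anchored norm `Φ′`, W2 data over `↥measOp` — built on this
  lineage's `B13StepEnvelopeEndUniform.uniform_ne5_of_record_restrict_envelope` (p218872; entry type quantified INSIDE `∃ C₅`, so the species index
  type `SpeciesRec D …` varies with `D`): the η-UNIFORMITY is the quantifier order `∃ C₅, ∀ 𝔾 D … Lsl …`.
CENSUS vs p222736 §2 (binders, by name): MINUS = [hwer, hc₁, hθ0, hθ1] (+ the implicit `c₁`; the implicit `θ` is now U1b's rate letter of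
`NE3Shape`, the input rate being `√(max θ L⁻¹)`); PLUS = [hL, hd, hreg, hα, hβ, hC, hNE3, ha′, hαη, hβη, hη, hdec₁, hcovA, hcovB, hdom₁, hΦ, hΛ₂, hS₂,
hdecΦ, hΔA, hΔB, hdom₂, hΨ, hΛ₃, hS₃, hdecΨ, hΓA, hΓB, hdom₃, hΛ₄, hΛ₅, hQ, hR] (+ their implicit data `𝒞 N dom RgV tow σ dist₁ B₁ δ₁ S₂ Φ Λ₂ dist₂ B₂ δ₂ σX
S₃ Ψ Λ₃ dist₃ B₃ δ₃ σB Λ₄ Λ₅`); renamed: telescope `ι c a s P dom V L ↦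
ιr cc ag sg Pm domZ Vv Lsl`, `o ↦ oc`, anchored-norm bound `hΦ ↦ hΦ′`; `θ ↦ √(max θ L⁻¹)` in `hins` ∕ `hθθ′`; rest IDENTICAL.  CENSUS vs p227161 §1:
MINUS = [R, S₀, M, hMA, hMB, rawA₀, rawB₀, hSA, hSB, hT] (instantiated ∕ memberships ∕ `rfl` ∕ factorised); PLUS = [the substrate telescope, hbdA, hmQA,
hmRA, hbdB, hmQB, hmRB, iopAt, hiopA]; rest IDENTICAL (specialised; `S₀.D.ω ↦ Lsl.ins.ω`, `S₀.rOp ↦ Lsl.rOp`, `S₀.rHist ↦ Lsl.rHist` by `rfl`).  So at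
the substrate's O1 instance the terminal E9 face displays ONLY `NE3Shape` + class ∕ threshold + O1 letters at the substrate's tables + the six letter
conditions + factorisation datum + W3 slice budgets + L05 ∕ L06 + `RawBounded` ×2 + floor + W4 `InsertionRate` + rooms + the activity-norm majorant
with decay split ∕ anchored norm (`0 ≤ Φ′`, `36Φ′ < 1`) + **`ActOpLineAnalyticOn`** + `ActExpLinearOn` over `↥measOp` + signs + `√(max θ L⁻¹) ≤ θ′ ≤ 1`,
`0 < ω < 1` and the TWO STRICT SIZE INEQUALITIES `cA(EA₀ + E₀) < 1 − ω`, `ω + (Φ′∕(1 − 36Φ′))·cA·(1 − ω)∕(1 − ω − cA(EA₀ + E₀)) < θ′` — no `hwer`, no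
rate binder, no `ρ₀ ∕ k₀ ∕ B`, no slot line, no `TransportReads`, no chart.  NOT decided here: whether Bałaban's constants satisfy the two inequalities
(leaf-10's `B13SmallnessCensus.md`).  Headline wording (trigger c5 ∕ referee INFO-38): «END ⇐ instance letters», never «leaf instantiated»; 0∕12 leaves
on Bałaban's concrete objects (O1 = substrate cell); spine 0∕9.  `FlowStep.BetaPertH`, (B), (B^μ) do not occur.  0 sorry; axioms ⊆ {propext,
Classical.choice, Quot.sound}.
-/

noncomputable section

open scoped BigOperators Matrix.Norms.L2Operator
open Metric Set

namespace Summit.QuantumFields.BalabanUV.T4Continuum.B13StepEnvelopeEndSubstrateBalaban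

open _root_.MeasureTheory
open Literature.MathematicalPhysics.QuantumFieldTheory.Balaban1983to89
open Literature.MathematicalPhysics.QuantumFieldTheory.Balaban1983to89.T4OutputRate (DecayBound NE5)
open Literature.MathematicalPhysics.QuantumFieldTheory.Balaban1983to89.T4InputCauchyRateSpecies (ballClass)
open Literature.MathematicalPhysics.QuantumFieldTheory.Balaban1983to89.B5Prop11Plancherel (Cst Tor fine)
open Literature.MathematicalPhysics.QuantumFieldTheory.Balaban1983to89.B5G183RateUnitTower (lev lev_neZero)
open Literature.MathematicalPhysics.QuantumFieldTheory.Balaban1983to89.T4EtaRateMin (NE3Shape)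
open Summit.QuantumFields.BalabanUV.T4Continuum
open Summit.QuantumFields.BalabanUV.T4Continuum.B13Carriers (TwoRuns)
open Summit.QuantumFields.BalabanUV.T4Continuum.B13OpDatum (OpDatum Species FormatBounded)
open Summit.QuantumFields.BalabanUV.T4Continuum.B13OpDatumJunctions (opOf RawBounded WeightedEntrywiseRate)
open Summit.QuantumFields.BalabanUV.T4Continuum.B13OpMeasurable (measOp)
open Summit.QuantumFields.BalabanUV.T4Continuum.B13HistMeasurable (MeasPotFrame B13HistM)
open Summit.QuantumFields.BalabanUV.T4Continuum.B13StepTermLabels (TermIdx InnerLabel)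
open Summit.QuantumFields.BalabanUV.T4Continuum.B13StepTermFamily (ActData ActExpLinearOn)
open Summit.QuantumFields.BalabanUV.T4Continuum.B13StepTermSocket (labelsIndexing)
open Summit.QuantumFields.BalabanUV.T4Continuum.B13InnerData (Bnd b13InnerData)
open Summit.QuantumFields.BalabanUV.T4Continuum.UrsellTreeSum (ind)
open Summit.QuantumFields.BalabanUV.T4Continuum.UrsellTermBudget (actSum)
open Summit.QuantumFields.BalabanUV.T4Continuum.B13DomainGeometryTR (SCube footprint domainGeometry)
open Summit.QuantumFields.BalabanUV.T4Continuum.B13Base (selfCtr)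
open Summit.QuantumFields.BalabanUV.T4Continuum.B13StepOfRecord (Slots assembly step outA outB)
open Summit.QuantumFields.BalabanUV.T4Continuum.B13StepOfRecordSub (assemblyOn restrict)
open Summit.QuantumFields.BalabanUV.T4Continuum.B13TermOpEnvelope (ActOpLineAnalyticOn)
open Summit.QuantumFields.BalabanUV.T4Continuum.B13StepEnvelopeEndSubstrate (exists_ne5_of_substrate_restrict_envelope_actNormDecay)
open Summit.QuantumFields.BalabanUV.T4Continuum.B13StepEndInsOpBalaban (sqrt_rate_pos_lt_one c1_balaban_nonneg)
open Summit.QuantumFields.BalabanUV.T4Continuum.B13StepOfRecordSubstrate (opA_mem_measOp_slotsOfRecord opB_mem_measOp_slotsOfRecord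
  transportReads_slotsOfRecord_of_factor)
open Summit.QuantumFields.BalabanUV.T4Continuum.B13ReadingsDecay (ReadsTowerCovA ReadsTowerCovB CovWeightDominatesDist)
open Summit.QuantumFields.BalabanUV.T4Continuum.B13ReadingsImage
open Summit.QuantumFields.BalabanUV.T4Continuum.B13ReadingsLocal (PotQLipschitzReading PotRLipschitzReading)
open Summit.QuantumFields.BalabanUV.T4Continuum.B13ReadingsAssembly (CpertRec)
open Summit.QuantumFields.BalabanUV.T4Continuum.SubstrateO1Readings (weightedEntrywiseRate_slotsOfRecord_balaban_ne3Shape)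
open Summit.QuantumFields.BalabanUV.T4Continuum.DecayRateInterpolation (EntryDecay)
open Summit.QuantumFields.BalabanUV.T4Continuum.SubstrateBackgroundTransporters (unitMod)
open Summit.QuantumFields.BalabanUV.T4Continuum.SubstrateTwoRunsDriven (DrivenRuns)
open Summit.QuantumFields.BalabanUV.T4Continuum.SubstrateRawSpecies (rawAOfRecord rawBOfRecord)
open Summit.QuantumFields.BalabanUV.T4Continuum.SubstrateSlotsOfRecord (SpeciesRec SlotLetters slotsOfRecord)
open Summit.QuantumFields.BalabanUV.T4Continuum.BalabanAveragedTowerUnit (idx)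
open Summit.QuantumFields.BalabanUV.T4Continuum.GaugeTermScalarData (QuT Q1)
open Summit.QuantumFields.BalabanUV.T4Continuum.RegularSiteTransporters (siteT)
open Summit.QuantumFields.BalabanUV.T4Continuum.RegularBackgroundTower (RegularTransporters)
open Summit.QuantumFields.BalabanUV.T4Continuum.NE2ColourPerturbedLayer (pertCovC)
open Summit.QuantumFields.BalabanUV.T4Continuum.NE2BalabanRoot (balabanPert)
open Summit.QuantumFields.BalabanUV.T4Continuum.NE2BalabanGauge (gaugeSlot liftR)
open Summit.QuantumFields.BalabanUV.T4Continuum.NE2BalabanThreshold (etaStar)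
open Summit.QuantumFields.BalabanUV.T4Continuum.NE2FromNE3Carrier (ne2Loc)
open Summit.QuantumFields.BalabanUV.T4Continuum.MinimalActionRate (minActReadings)

/-! ## §1 E9[rec,sub] of record at Bałaban's tier-B background, STATED AT THE SUBSTRATE's O1 INSTANCE -/

section Instance

-- the substrate's telescope for `slotsOfRecord` (p220104 §SlotsRecord; letter names as in `SubstrateO1Readings` ∕ p226898)
variable {𝔾 : Type} [GaugeGroup 𝔾] (D : DrivenRuns 𝔾)
variable {oc : Type} [Fintype oc] [DecidableEq oc] (ιr : 𝔾 →* Matrix oc oc ℂ) (cc : ℂ) (ag : ℝ) (sg : ℕ → ℂ)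
variable {T ι' Sy Ω 𝒴 : Type} [MeasurableSpace Ω] (Pm : MeasPotFrame D.carriers) {IOp : Type*}
  (𝒵 : D.carriers.Dom → InnerLabel D.carriers.Dom (Bnd D.toTwoRuns) → Type) [∀ Z j, Fintype (𝒵 Z j)] (domZ : ∀ Z j, 𝒵 Z j → D.carriers.Dom)
  (Jc : D.carriers.Dom → InnerLabel D.carriers.Dom (Bnd D.toTwoRuns) → Type) [∀ Z j, Fintype (Jc Z j)]
  (Vv : D.carriers.Dom → InnerLabel D.carriers.Dom (Bnd D.toTwoRuns) → Type) [∀ Z j, NormedAddCommGroup (Vv Z j)]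
  [∀ Z j, InnerProductSpace ℝ (Vv Z j)] [∀ Z j, MeasurableSpace (Vv Z j)] [∀ Z j, BorelSpace (Vv Z j)] [∀ Z j, FiniteDimensional ℝ (Vv Z j)]
  (mI : D.carriers.Dom → InnerLabel D.carriers.Dom (Bnd D.toTwoRuns) → Type) [∀ Z j, Fintype (mI Z j)] [∀ Z j, DecidableEq (mI Z j)]
  (Lsl : SlotLetters D (o := oc) (T := T) (ι' := ι') (S := Sy) (Ω := Ω) (𝒴 := 𝒴) Pm (IOp := IOp) 𝒵 domZ Jc Vv mI)
-- node NE3 ∕ the owner's letters (sizes)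
variable {d : ℕ} (L : ℕ) [NeZero L] (M : Fin d → ℕ) [hM : ∀ μ, NeZero (M μ)] (a : ℝ) (ha : 0 < a)
variable {o : Type*} [Fintype o] [DecidableEq o] {α β C a' η : ℝ} {m : Type*} [Fintype m] [DecidableEq m]
-- the measurable sort of the `ActExpLinearOn` datum (as in p222736)
variable {Ω' : Type*} [MeasurableSpace Ω']

/-- [folklore] **THE CAUCHY-ENVELOPE END OF RECORD OVER THE MEASURABLE OPERATOR CARRIER, W1 PRODUCED AT BAŁABAN's TIER-B BACKGROUND, ARITHMETIC
LETTERS ELIMINATED — AT THE SUBSTRATE's O1 INSTANCE** `S₀ := slotsOfRecord D ιr cc ag sg Pm 𝒵 domZ Jc Vv mI Lsl`, `M := measOp T (…) ι′ Ω 𝒴`: this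
lineage's `B13StepEnvelopeEndSubstrate.exists_ne5_of_substrate_restrict_envelope_actNormDecay` (p222736 §2) with `hwer` SUPPLIED BY NAME by substrate-p1's
`weightedEntrywiseRate_slotsOfRecord_balaban_ne3Shape` (so U1b's `NE3Shape` (OPEN), the class ∕ threshold letters `hreg hα hβ hC ha' hαη hβη hη` and the
owner's O1 letters AT THE SUBSTRATE's TABLES `hdec₁ … hR` are displayed instead; run A read THROUGH THE TRANSPORTER), `hc₁ ∕ hθ0 ∕ hθ1` discharged
(p225077 §1); the six LETTER conditions (p221190 §1), the factorisation datum `(iopAt, hiopA)` (p221190 §2) and EVERY OTHER binder of p222736 §2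
VERBATIM, at input rate `√(max θ L⁻¹)`.  Conclusion LITERALLY `∃ C₅, T4OutputRate.NE5 (B13StepOfRecord.outA (slotsOfRecord …) E₀ cB)
(B13StepOfRecord.outB (slotsOfRecord …) E₀ cB) W κ θ′ C₅` at the PRESCRIBED `θ′`.  NOT a proof of NE5 ∕ NE2 ∕ NE3: an implication from displayed
binders about the substrate's letters and node NE3's admissible data (W2-op `ActOpLineAnalyticOn` over `↥measOp` among them); nothing of Bałaban's is
asserted. -/
theorem exists_ne5_of_substrate_restrict_envelope_balaban_ne3Shape (E₀ cB : ℝ)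
    {𝒞 : ℕ → Set (B7Prop1Explicit.Site d → Fin d → (Matrix o o ℂ)ˣ)} {N : ℕ}
    {dom : Set (B7Prop1Explicit.Site d → Fin d → (Matrix o o ℂ)ˣ)} (hL : 2 ≤ L) (hd : 1 ≤ d)
    {RgV : (B7Prop1Explicit.Site d → Fin d → (Matrix o o ℂ)ˣ) → ((k : ℕ) → Fin d → (Tor (fine (lev L k) M) → Matrix o o ℂ))}
    (hreg : ∀ V ∈ dom, RegularTransporters L M (liftR L M (RgV V)) α β) (hα : 0 ≤ α) (hβ : 0 ≤ β) (hC : 0 ≤ C) {θ : ℝ}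
    (hNE3 : NE3Shape (minActReadings d 𝒞 L N dom (ne2Loc L M fun V => liftR L M (RgV V))) C θ)
    (ha' : 0 < a') (hαη : α ≤ η) (hβη : β ≤ η) (hη : η ≤ etaStar o d a a')
    -- the towers over the two-run object's run-B backgrounds and the window
    {tow : ℕ → (ℕ → ℝ) → D.toTwoRuns.carriers.BgB → ↥dom} {W : Set (ℕ → ℝ)}
    -- the covariance species, read at the substrate's V1 operator entries
    {σ : T → ((Tor (unitMod (D.F.P D.K)) × Fin (D.F.P D.K).d) × oc) → idx L M 0 × o} {dist₁ : idx L M 0 × o → idx L M 0 × o → ℝ} {B₁ δ₁ : ℝ}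
    (hdec₁ : ∀ V ∈ dom, ∀ k, EntryDecay dist₁
      (pertCovC L M a ha (balabanPert L M a (liftR L M (RgV V)) (gaugeSlot L M (RgV V) (QuT L M o (siteT L M (RgV V))) (Q1 L M o) a'))
        1 k) B₁ δ₁)
    (hcovA : ReadsTowerCovA
      (fun V : ↥dom => pertCovC L M a ha
        (balabanPert L M a (liftR L M (RgV V)) (gaugeSlot L M (RgV V) (QuT L M o (siteT L M (RgV V))) (Q1 L M o) a')) 1)
      σ tow (fun g U k => (rawAOfRecord ιr D cc ag sg Lsl.ΓA Lsl.dkA Lsl.gcA Lsl.pQA Lsl.pRA) g (D.toTwoRuns.carriers.transport U) k) W)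
    (hcovB : ReadsTowerCovB
      (fun V : ↥dom => pertCovC L M a ha
        (balabanPert L M a (liftR L M (RgV V)) (gaugeSlot L M (RgV V) (QuT L M o (siteT L M (RgV V))) (Q1 L M o) a')) 1)
      σ tow (rawBOfRecord ιr D cc ag sg Lsl.ΓB Lsl.dkB Lsl.gcB Lsl.pQB Lsl.pRB) W)
    (hdom₁ : CovWeightDominatesDist (slotsOfRecord D ιr cc ag sg Pm 𝒵 domZ Jc Vv mI Lsl).F dist₁ σ (δ₁ / 2))
    -- the `deltaKer` species
    {S₂ : Set (Matrix (idx L M 0 × o) (idx L M 0 × o) ℂ)} {Φ : T → Matrix (idx L M 0 × o) (idx L M 0 × o) ℂ → Matrix m m ℂ}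
    {Λ₂ : ℝ} (hΦ : ∀ t, OpLipschitzOn S₂ (Φ t) Λ₂) (hΛ₂ : 0 ≤ Λ₂)
    (hS₂ : ∀ V ∈ dom, ∀ k, pertCovC L M a ha
      (balabanPert L M a (liftR L M (RgV V)) (gaugeSlot L M (RgV V) (QuT L M o (siteT L M (RgV V))) (Q1 L M o) a')) 1 k ∈ S₂)
    {dist₂ : m → m → ℝ} {B₂ δ₂ : ℝ}
    (hdecΦ : ∀ V ∈ dom, ∀ t k, EntryDecay dist₂ (Φ t (pertCovC L M a ha
      (balabanPert L M a (liftR L M (RgV V)) (gaugeSlot L M (RgV V) (QuT L M o (siteT L M (RgV V))) (Q1 L M o) a')) 1 k)) B₂ δ₂)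
    {σX : T → ι' → m}
    (hΔA : ReadsTowerDeltaA (fun (V : ↥dom) t k => Φ t (pertCovC L M a ha
      (balabanPert L M a (liftR L M (RgV V)) (gaugeSlot L M (RgV V) (QuT L M o (siteT L M (RgV V))) (Q1 L M o) a')) 1 k))
      σX tow (fun g U k => (rawAOfRecord ιr D cc ag sg Lsl.ΓA Lsl.dkA Lsl.gcA Lsl.pQA Lsl.pRA) g (D.toTwoRuns.carriers.transport U) k) W)
    (hΔB : ReadsTowerDeltaB (fun (V : ↥dom) t k => Φ t (pertCovC L M a ha
      (balabanPert L M a (liftR L M (RgV V)) (gaugeSlot L M (RgV V) (QuT L M o (siteT L M (RgV V))) (Q1 L M o) a')) 1 k))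
      σX tow (rawBOfRecord ιr D cc ag sg Lsl.ΓB Lsl.dkB Lsl.gcB Lsl.pQB Lsl.pRB) W)
    (hdom₂ : DeltaWeightDominatesDist (slotsOfRecord D ιr cc ag sg Pm 𝒵 domZ Jc Vv mI Lsl).F dist₂ σX (δ₂ / 2))
    -- the `gammaConstituent` species
    {S₃ : Set (Matrix (idx L M 0 × o) (idx L M 0 × o) ℂ)} {Ψ : T → Matrix (idx L M 0 × o) (idx L M 0 × o) ℂ → Matrix m m ℂ}
    {Λ₃ : ℝ} (hΨ : ∀ t, OpLipschitzOn S₃ (Ψ t) Λ₃) (hΛ₃ : 0 ≤ Λ₃)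
    (hS₃ : ∀ V ∈ dom, ∀ k, pertCovC L M a ha
      (balabanPert L M a (liftR L M (RgV V)) (gaugeSlot L M (RgV V) (QuT L M o (siteT L M (RgV V))) (Q1 L M o) a')) 1 k ∈ S₃)
    {dist₃ : m → m → ℝ} {B₃ δ₃ : ℝ}
    (hdecΨ : ∀ V ∈ dom, ∀ t k, EntryDecay dist₃ (Ψ t (pertCovC L M a ha
      (balabanPert L M a (liftR L M (RgV V)) (gaugeSlot L M (RgV V) (QuT L M o (siteT L M (RgV V))) (Q1 L M o) a')) 1 k)) B₃ δ₃)
    {σB : T → ((Tor (unitMod (D.F.P D.K)) × Fin (D.F.P D.K).d) × oc) → m}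
    (hΓA : ReadsTowerGammaA (fun (V : ↥dom) t k => Ψ t (pertCovC L M a ha
      (balabanPert L M a (liftR L M (RgV V)) (gaugeSlot L M (RgV V) (QuT L M o (siteT L M (RgV V))) (Q1 L M o) a')) 1 k))
      σB σX tow (fun g U k => (rawAOfRecord ιr D cc ag sg Lsl.ΓA Lsl.dkA Lsl.gcA Lsl.pQA Lsl.pRA) g (D.toTwoRuns.carriers.transport U) k) W)
    (hΓB : ReadsTowerGammaB (fun (V : ↥dom) t k => Ψ t (pertCovC L M a ha
      (balabanPert L M a (liftR L M (RgV V)) (gaugeSlot L M (RgV V) (QuT L M o (siteT L M (RgV V))) (Q1 L M o) a')) 1 k))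
      σB σX tow (rawBOfRecord ιr D cc ag sg Lsl.ΓB Lsl.dkB Lsl.gcB Lsl.pQB Lsl.pRB) W)
    (hdom₃ : GammaWeightDominatesDist (slotsOfRecord D ιr cc ag sg Pm 𝒵 domZ Jc Vv mI Lsl).F dist₃ σB σX (δ₃ / 2))
    -- the potential species
    {Λ₄ Λ₅ : ℝ} (hΛ₄ : 0 ≤ Λ₄) (hΛ₅ : 0 ≤ Λ₅)
    (hQ : PotQLipschitzReading (minActReadings d 𝒞 L N dom (ne2Loc L M fun V => liftR L M (RgV V))) (slotsOfRecord D ιr cc ag sg Pm 𝒵 domZ Jc Vv mI Lsl).F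
      (fun g U k => (rawAOfRecord ιr D cc ag sg Lsl.ΓA Lsl.dkA Lsl.gcA Lsl.pQA Lsl.pRA) g (D.toTwoRuns.carriers.transport U) k)
      (rawBOfRecord ιr D cc ag sg Lsl.ΓB Lsl.dkB Lsl.gcB Lsl.pQB Lsl.pRB) W Λ₄)
    (hR : PotRLipschitzReading (minActReadings d 𝒞 L N dom (ne2Loc L M fun V => liftR L M (RgV V))) (slotsOfRecord D ιr cc ag sg Pm 𝒵 domZ Jc Vv mI Lsl).F
      (fun g U k => (rawAOfRecord ιr D cc ag sg Lsl.ΓA Lsl.dkA Lsl.gcA Lsl.pQA Lsl.pRA) g (D.toTwoRuns.carriers.transport U) k)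
      (rawBOfRecord ιr D cc ag sg Lsl.ΓB Lsl.dkB Lsl.gcB Lsl.pQB Lsl.pRB) W Λ₅)
    -- leaf-01-g11's six LETTER conditions (replace `hMA` ∕ `hMB`; p221190 §1)
    (hbdA : ∀ (g : ℕ → ℝ) (U : D.carriers.BgA) (k : ℕ),
      FormatBounded (Lsl.W k).format (rawAOfRecord ιr D cc ag sg Lsl.ΓA Lsl.dkA Lsl.gcA Lsl.pQA Lsl.pRA g U k).kernel)
    (hmQA : ∀ (r : ℝ) (U : GaugeField (D.F.P D.K) 0 𝔾) (k : ℕ) (Y : 𝒴) (b b' : ((Tor (unitMod (D.F.P D.K)) × Fin (D.F.P D.K).d) × oc)),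
        Measurable fun x : Ω => Lsl.pQA r U k x Y b b')
    (hmRA : ∀ (r : ℝ) (U : GaugeField (D.F.P D.K) 0 𝔾) (k : ℕ) (Y : 𝒴), Measurable fun x : Ω => Lsl.pRA r U k x Y)
    (hbdB : ∀ (g : ℕ → ℝ) (U : D.carriers.BgB) (k : ℕ),
      FormatBounded (Lsl.W k).format (rawBOfRecord ιr D cc ag sg Lsl.ΓB Lsl.dkB Lsl.gcB Lsl.pQB Lsl.pRB g U k).kernel)
    (hmQB : ∀ (r : ℝ) (U : GaugeField (D.F.P (D.K + 1)) 0 𝔾) (k : ℕ) (Y : 𝒴) (b b' : ((Tor (unitMod (D.F.P D.K)) × Fin (D.F.P D.K).d) × oc)),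
        Measurable fun x : Ω => Lsl.pQB r U k x Y b b')
    (hmRB : ∀ (r : ℝ) (U : GaugeField (D.F.P (D.K + 1)) 0 𝔾) (k : ℕ) (Y : 𝒴), Measurable fun x : Ω => Lsl.pRB r U k x Y)
    -- leaf-01-g11's factorisation datum (replaces the L01 reading `hT`; p221190 §2)
    (iopAt : ℝ → D.carriers.BgA → ℕ → IOp)
    (hiopA : ∀ (r : ℝ) (U : D.carriers.BgB) (k : ℕ), Lsl.ins.iopA r U k = iopAt r (D.carriers.transport U) k)
    -- the rest of E9[rec,sub] at the instance, BY NAME from p222736 §2 (VERBATIM; anchored-norm bound renamed `hΦ'`)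
    {ROp RHist : ℕ → ℝ}
    {A A' : ℕ → (ℕ → ℝ) → D.toTwoRuns.carriers.BgB → D.toTwoRuns.carriers.Dom → InnerLabel D.toTwoRuns.carriers.Dom (Bnd D.toTwoRuns) → ℝ}
    {Dt : ActData D.toTwoRuns.carriers.Dom (InnerLabel D.toTwoRuns.carriers.Dom (Bnd D.toTwoRuns)) (measOp T ((Tor (unitMod (D.F.P D.K)) × Fin (D.F.P D.K).d) × oc) ι' Ω 𝒴) (B13HistM Pm) Ω'}
    {κ Φ' EA₀ cA r₀ δ' θ' : ℝ}
    (hbB : (assembly (slotsOfRecord D ιr cc ag sg Pm 𝒵 domZ Jc Vv mI Lsl)).SliceBudgetB W κ cB)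
    (hbA : (slotsOfRecord D ιr cc ag sg Pm 𝒵 domZ Jc Vv mI Lsl).D.SliceBudget (step (slotsOfRecord D ιr cc ag sg Pm 𝒵 domZ Jc Vv mI Lsl) E₀ cB) W κ cA)
    (hdA : DecayBound (B13StepOfRecord.outA (slotsOfRecord D ιr cc ag sg Pm 𝒵 domZ Jc Vv mI Lsl) E₀ cB) W EA₀ κ)
    (hdB : DecayBound (B13StepOfRecord.outB (slotsOfRecord D ιr cc ag sg Pm 𝒵 domZ Jc Vv mI Lsl) E₀ cB) W E₀ κ)
    (hRA : RawBounded (slotsOfRecord D ιr cc ag sg Pm 𝒵 domZ Jc Vv mI Lsl).F (assembly (slotsOfRecord D ιr cc ag sg Pm 𝒵 domZ Jc Vv mI Lsl)).rawAt W)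
    (hRB : RawBounded (slotsOfRecord D ιr cc ag sg Pm 𝒵 domZ Jc Vv mI Lsl).F (slotsOfRecord D ιr cc ag sg Pm 𝒵 domZ Jc Vv mI Lsl).rawB W)
    (hfl : ∀ k, r₀ ≤ Lsl.rOp k)
    (hins : (step (slotsOfRecord D ιr cc ag sg Pm 𝒵 domZ Jc Vv mI Lsl) E₀ cB).InsertionRate W κ E₀ δ' (Real.sqrt (max θ ((L : ℝ)⁻¹))))
    (hOp : ∀ k, Lsl.rOp k ≤ ROp k) (hHist : ∀ k, (assembly (slotsOfRecord D ιr cc ag sg Pm 𝒵 domZ Jc Vv mI Lsl)).bHist E₀ cB k + Lsl.rHist k ≤ RHist k)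
    (hA : ∀ k, ∀ g ∈ W, ∀ (U : D.toTwoRuns.carriers.BgB) (q : (measOp T ((Tor (unitMod (D.F.P D.K)) × Fin (D.F.P D.K).d) × oc) ι' Ω 𝒴) × B13HistM Pm),
      q ∈ (ballClass (selfCtr (assemblyOn (restrict (slotsOfRecord D ιr cc ag sg Pm 𝒵 domZ Jc Vv mI Lsl) (measOp T ((Tor (unitMod (D.F.P D.K)) × Fin (D.F.P D.K).d) × oc) ι' Ω 𝒴)
          (opA_mem_measOp_slotsOfRecord D ιr cc ag sg Pm 𝒵 domZ Jc Vv mI Lsl hbdA hmQA hmRA)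
          (opB_mem_measOp_slotsOfRecord D ιr cc ag sg Pm 𝒵 domZ Jc Vv mI Lsl hbdB hmQB hmRB))).raw
        (assemblyOn (restrict (slotsOfRecord D ιr cc ag sg Pm 𝒵 domZ Jc Vv mI Lsl) (measOp T ((Tor (unitMod (D.F.P D.K)) × Fin (D.F.P D.K).d) × oc) ι' Ω 𝒴)
          (opA_mem_measOp_slotsOfRecord D ιr cc ag sg Pm 𝒵 domZ Jc Vv mI Lsl hbdA hmQA hmRA)
          (opB_mem_measOp_slotsOfRecord D ιr cc ag sg Pm 𝒵 domZ Jc Vv mI Lsl hbdB hmQB hmRB))).histRef) ROp RHist) k g U →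
        ∀ X : D.toTwoRuns.carriers.Dom, D.toTwoRuns.carriers.scale X = k → ∀ i : TermIdx D.toTwoRuns.carriers.Dom (Bnd D.toTwoRuns),
          (labelsIndexing (domainGeometry D.toTwoRuns) (b13InnerData D.toTwoRuns)).Rel k i X → ∀ m,
            ‖(slotsOfRecord D ιr cc ag sg Pm 𝒵 domZ Jc Vv mI Lsl).act ((labelsIndexing (domainGeometry D.toTwoRuns) (b13InnerData D.toTwoRuns)).poly i m) ((labelsIndexing (domainGeometry D.toTwoRuns) (b13InnerData D.toTwoRuns)).lab i m) (q.1 : OpDatum (SpeciesRec D oc T ι' Ω 𝒴)) q.2‖ ≤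
              A k g U ((labelsIndexing (domainGeometry D.toTwoRuns) (b13InnerData D.toTwoRuns)).poly i m) ((labelsIndexing (domainGeometry D.toTwoRuns) (b13InnerData D.toTwoRuns)).lab i m))
    (hA0 : ∀ k g U Z ℓ, 0 ≤ A k g U Z ℓ) (hA0' : ∀ k g U Z ℓ, 0 ≤ A' k g U Z ℓ) (hκ : 0 ≤ κ)
    (hdec : ∀ k g U Z ℓ, A k g U Z ℓ ≤ A' k g U Z ℓ * Real.exp (-(κ * (D.toTwoRuns.carriers.d Z + 5))))
    (hΦ0 : 0 ≤ Φ') (hΦsmall : 36 * Φ' < 1)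
    (hΦ' : ∀ k, ∀ g ∈ W, ∀ (U : D.toTwoRuns.carriers.BgB) (q : SCube D.toTwoRuns),
      ∑ Z ∈ D.toTwoRuns.domAt k, ind (q ∈ footprint Z) * actSum (b13InnerData D.toTwoRuns) (A' k g U) k Z *
        Real.exp ((footprint Z).card) ≤ Φ')
    (hact : ActOpLineAnalyticOn (labelsIndexing (domainGeometry D.toTwoRuns) (b13InnerData D.toTwoRuns)) (restrict (slotsOfRecord D ιr cc ag sg Pm 𝒵 domZ Jc Vv mI Lsl) (measOp T ((Tor (unitMod (D.F.P D.K)) × Fin (D.F.P D.K).d) × oc) ι' Ω 𝒴)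
          (opA_mem_measOp_slotsOfRecord D ιr cc ag sg Pm 𝒵 domZ Jc Vv mI Lsl hbdA hmQA hmRA)
          (opB_mem_measOp_slotsOfRecord D ιr cc ag sg Pm 𝒵 domZ Jc Vv mI Lsl hbdB hmQB hmRB)).act
      (ballClass (selfCtr (assemblyOn (restrict (slotsOfRecord D ιr cc ag sg Pm 𝒵 domZ Jc Vv mI Lsl) (measOp T ((Tor (unitMod (D.F.P D.K)) × Fin (D.F.P D.K).d) × oc) ι' Ω 𝒴)
          (opA_mem_measOp_slotsOfRecord D ιr cc ag sg Pm 𝒵 domZ Jc Vv mI Lsl hbdA hmQA hmRA)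
          (opB_mem_measOp_slotsOfRecord D ιr cc ag sg Pm 𝒵 domZ Jc Vv mI Lsl hbdB hmQB hmRB))).raw
        (assemblyOn (restrict (slotsOfRecord D ιr cc ag sg Pm 𝒵 domZ Jc Vv mI Lsl) (measOp T ((Tor (unitMod (D.F.P D.K)) × Fin (D.F.P D.K).d) × oc) ι' Ω 𝒴)
          (opA_mem_measOp_slotsOfRecord D ιr cc ag sg Pm 𝒵 domZ Jc Vv mI Lsl hbdA hmQA hmRA)
          (opB_mem_measOp_slotsOfRecord D ιr cc ag sg Pm 𝒵 domZ Jc Vv mI Lsl hbdB hmQB hmRB))).histRef) ROp RHist) W)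
    (hexp : ActExpLinearOn (labelsIndexing (domainGeometry D.toTwoRuns) (b13InnerData D.toTwoRuns)) (restrict (slotsOfRecord D ιr cc ag sg Pm 𝒵 domZ Jc Vv mI Lsl) (measOp T ((Tor (unitMod (D.F.P D.K)) × Fin (D.F.P D.K).d) × oc) ι' Ω 𝒴)
          (opA_mem_measOp_slotsOfRecord D ιr cc ag sg Pm 𝒵 domZ Jc Vv mI Lsl hbdA hmQA hmRA)
          (opB_mem_measOp_slotsOfRecord D ιr cc ag sg Pm 𝒵 domZ Jc Vv mI Lsl hbdB hmQB hmRB)).act Dt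
      (ballClass (selfCtr (assemblyOn (restrict (slotsOfRecord D ιr cc ag sg Pm 𝒵 domZ Jc Vv mI Lsl) (measOp T ((Tor (unitMod (D.F.P D.K)) × Fin (D.F.P D.K).d) × oc) ι' Ω 𝒴)
          (opA_mem_measOp_slotsOfRecord D ιr cc ag sg Pm 𝒵 domZ Jc Vv mI Lsl hbdA hmQA hmRA)
          (opB_mem_measOp_slotsOfRecord D ιr cc ag sg Pm 𝒵 domZ Jc Vv mI Lsl hbdB hmQB hmRB))).raw
        (assemblyOn (restrict (slotsOfRecord D ιr cc ag sg Pm 𝒵 domZ Jc Vv mI Lsl) (measOp T ((Tor (unitMod (D.F.P D.K)) × Fin (D.F.P D.K).d) × oc) ι' Ω 𝒴)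
          (opA_mem_measOp_slotsOfRecord D ιr cc ag sg Pm 𝒵 domZ Jc Vv mI Lsl hbdA hmQA hmRA)
          (opB_mem_measOp_slotsOfRecord D ιr cc ag sg Pm 𝒵 domZ Jc Vv mI Lsl hbdB hmQB hmRB))).histRef) ROp RHist) W)
    (hE₀ : 0 ≤ E₀) (hcA : 0 ≤ cA) (hcB : 0 ≤ cB) (hr₀ : 0 < r₀) (hδ' : 0 ≤ δ')
    (hθθ' : Real.sqrt (max θ ((L : ℝ)⁻¹)) ≤ θ') (hθ'1 : θ' ≤ 1) (hω : 0 < Lsl.ins.ω) (hω1 : Lsl.ins.ω < 1)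
    (hh : cA * (EA₀ + E₀) < 1 - Lsl.ins.ω)
    (hsmall : Lsl.ins.ω + Φ' / (1 - 36 * Φ') * cA * (1 - Lsl.ins.ω) / (1 - Lsl.ins.ω - cA * (EA₀ + E₀)) < θ') :
    ∃ C₅, NE5 (B13StepOfRecord.outA (slotsOfRecord D ιr cc ag sg Pm 𝒵 domZ Jc Vv mI Lsl) E₀ cB) (B13StepOfRecord.outB (slotsOfRecord D ιr cc ag sg Pm 𝒵 domZ Jc Vv mI Lsl) E₀ cB) W κ θ' C₅ :=
  exists_ne5_of_substrate_restrict_envelope_actNormDecay D ιr cc ag sg Pm 𝒵 domZ Jc Vv mI Lsl E₀ cB hbdA hmQA hmRA hbdB hmQB hmRB iopAt hiopA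
    hbB hbA hdA hdB hRA hRB
    (weightedEntrywiseRate_slotsOfRecord_balaban_ne3Shape D ιr cc ag sg Pm 𝒵 domZ Jc Vv mI Lsl L M a ha hL hd hreg hα hβ hC hNE3 ha' hαη hβη
      hη hdec₁ hcovA hcovB hdom₁ hΦ hΛ₂ hS₂ hdecΦ hΔA hΔB hdom₂ hΨ hΛ₃ hS₃ hdecΨ hΓA hΓB hdom₃ hΛ₄ hΛ₅ hQ hR)
    hfl hins hOp hHist hA hA0 hA0' hκ hdec hΦ0 hΦsmall hΦ' hact hexp hE₀ hcA hcB (c1_balaban_nonneg L a hC hΛ₄ hΛ₅) hr₀ hδ'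
    (sqrt_rate_pos_lt_one L hL hNE3.rate_lt_one).1 (sqrt_rate_pos_lt_one L hL hNE3.rate_lt_one).2 hθθ' hθ'1 hω hω1 hh hsmall

end Instance

end Summit.QuantumFields.BalabanUV.T4Continuum.B13StepEnvelopeEndSubstrateBalaban

end
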